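import Summits.QuantumFields.BalabanUV.T4Continuum.Support.NE3EnergyShapes

/-!
# T⁴ programme, node NE3, route P2 «ENERGY CONVEXITY» — leaf L9 IN THE ROUTE'S CURRENCY (typer row Y9): the dual
# residual of the block-averaged run-B minimiser against a run-A tangent direction, from row NE3-R2's
# `dualResidual_avgIter` BY NAME, for minimisers of the owner's small-field class: `|d/ds|₀ A(W e^{sX})| ≤
# residualScale(d,L,N,b,g,k) · energyNorm_W(X)`

Eleventh generation of the NE3 prover lineage P2 (unit `b2b-balaban-t4-ne3-p2`, co-owner #2 of `BINDER-OWNERS.md` row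
NE3; ROUND-2 SKELETON-FIRST mandate), typer row Y9 of the skeleton `HOME/t4/skeletons/NE3-t4-ne3-p2.md`: the
`hres` input of `Support/NE3EnergyPath.energyResponse_of_pathData` (p206756) in the EXACT form the torus assembly
needs.  Given a run-B minimiser `U_B` of the owner's small-field class `sfClass L N ε (k+1)`
(`MinimalActionSandwich.IsMinimiser`, p204506) that is `Regular d L N b g (k+1)` (p204845) with `b < ε`, and the
multi-level smallness `LevelSmall d L k (ε/(L^{k+1})²)` of row NE3-R2 (p204817), put `W := cavg L U_B`
(`= rescale L (bavg L U_B)`, the block average read on run A's lattice).  THEN for every periodic `𝔲(N)` direction `X`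
on run A's lattice tangent to run A's constraint fibre at `W` (`TangentIter L (k−1) W X`, i.e. `D(avgIter k)(W)[X] = 0`)
and every derivative `D` at `0` of `s ↦ A_{period}(W e^{sX})` (the run-A Wilson action of one period):
  `|D| ≤ residualScale d L N b g k · energyNorm W X (periodBox (N·L^k))`
(**`abs_deriv_action_le_residualScale`**, §3), where `energyNorm W X F = √(curlSq W X F + dirSq X F)` and
`residualScale = L^{4−d}·wallConst·[√(g N^d (L^{k+1})^{d−6})·dualC2 + (b/(L^{k+1})²)²·dualC1·√(d (N L^k)^d)]`
(the definitions of `Support/NE3EnergyShapes`, imported BY NAME).  Every analytic input is row NE3-R2's `dualResidual_avgIter` (β-per + residual pairing +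
periodic lift + Fermat, all PROVED); this file is plumbing: the minimiser of the class satisfies the competitor
hypothesis of that theorem (§2 `fineAction_le_of_isMinimiser`), the run-A action of `W e^{sX}` IS the coarse action of
`\overline{U_B} e^{sΦ}` for the `L`-lattice copy `Φ` of `X` (§2 `fineAction_vary_cavg`), and the bracket is dominated by
the energy norm (§3, `coarseL1_le_sqrt`).  All [folklore].

HONEST FRAMING.  Finite-T⁴ bookkeeping (rung (B)+1); nothing about NE3 is asserted beyond row NE3-R2's theorem; no
conditional of the cell is used or hidden; NOT infinite volume ∕ mass gap ∕ Clay ∕ summit progress; NE3 NOT proved.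
ABSOLUTE RULE kept: no printed sentence is a hypothesis (context: [Balaban1985Variational] (26)–(27) p. 282, §E p. 295).
PLACEMENT: `Summits/QuantumFields/BalabanUV/`; imports `Support.NE3EnergyShapes` only (which imports the accepted
`Support.MinimalActionWitness` and `Support.AveragingDeficitMultiLevelBridge`); moves nothing.
-/

set_option autoImplicit false

open scoped BigOperators Matrix Matrix.Norms.L2Operator
open NormedSpace Finset

namespace Summit.QuantumFields.BalabanUV.T4Continuum.NE3EnergyResidual

open Literature.MathematicalPhysics.QuantumFieldTheory.Balaban1983to89
open B7Prop1Explicit B7Prop2Explicit MatrixLog UnitaryModel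
open T4AveragingDeficitWall hiding Site Plane Plaq Bond
open T4AveragingDeficitWallBoundary (IsPeriodicCfg periodBox blockSites_periodBox)
open AveragingDeficitPeriodicCounting (IsPeriodicDir)
open AveragingDeficitDerivWallProof (wallConst wallConst_nonneg)
open AveragingDeficitResidualPairing (coarseActionOf)
open AveragingDeficitDualResidual (dualC1 dualC2 coarseL1 coarseSq coarseL1_le_sqrt coarseSq_nonneg)
open AveragingDeficitChartCalculus (cavg)
open AveragingDeficitMultiLevelPrep (tower LevelSmall TangentIter)
open AveragingDeficitMultiLevelBridge (dualResidual_avgIter tower_eq cavgIter_eq_avgIter)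
open MinimalActionLevels (perWin levelAction stepWt stepWt_pos fhol_rescale)
open MinimalActionSandwich (IsMinimiser admissible)
open MinimalActionRate (Regular sfClass)
open NE3EnergyShapes (energyNorm residualScale)

noncomputable section

variable {d : ℕ} {n : Type*} [Fintype n] [DecidableEq n]

/-! ## §1 The route's currency: `NE3EnergyShapes.energyNorm`, `NE3EnergyShapes.residualScale` (imported) -/

/-! ## §2 Plumbing: the class minimiser as a competitor-minimiser; the run-A action as a coarse action -/

/-- A minimiser of the owner's class `sfClass L N ε` at level `m` has least fine action over the period among all
`U(N)`-valued, `(N·L^m)`-periodic configurations of plaquette radius `ε/(L^m)²` with the same `m`-fold average — the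
competitor hypothesis `hmin` of row NE3-R2's `dualResidual_avgIter`. [folklore] -/
theorem fineAction_le_of_isMinimiser {L N m : ℕ} (hL : 1 ≤ L) {ε : ℝ} {V UB : B7Prop1Explicit.Site d → Fin d → (Matrix n n ℂ)ˣ}
    (hB : IsMinimiser d (sfClass d L N ε) L N m V UB) (U : B7Prop1Explicit.Site d → Fin d → (Matrix n n ℂ)ˣ)
    (hU : IsUnitaryCfg U) (hUP : IsPeriodicCfg U ((N * L ^ m : ℕ) : ℤ)) (hUb : SmallField U (ε / ((L : ℝ) ^ m) ^ 2))
    (havg : avgIter L U m = avgIter L UB m) :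
    fineAction UB (perWin d (N * L ^ m)) ≤ fineAction U (perWin d (N * L ^ m)) := by
  have hadm : U ∈ admissible (sfClass d L N ε) L m V := ⟨⟨hU, hUP, hUb⟩, by rw [havg]; exact hB.mem.2⟩
  have h := hB.le U hadm
  unfold MinimalActionLevels.levelAction at h
  have hc : 0 < ((stepWt d L)⁻¹) ^ m := pow_pos (inv_pos.mpr (stepWt_pos (d := d) L hL)) m
  exact le_of_mul_le_mul_left h hc

/-- The `L`-lattice copy of a run-A direction: `Φ(z) := X(z / L)` (coordinatewise integer division), so that
`Φ(L•y) = X(y)`. [folklore] -/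
def liftDir (L : ℕ) (X : B7Prop1Explicit.Site d → Fin d → Matrix n n ℂ) : B7Prop1Explicit.Site d → Fin d → Matrix n n ℂ :=
  fun z κ => X (fun i => z i / (L : ℤ)) κ

omit [Fintype n] [DecidableEq n] in
/-- `Φ(L•y) = X(y)` for `L ≥ 1`. [folklore] -/
theorem liftDir_smul {L : ℕ} (hL : 1 ≤ L) (X : B7Prop1Explicit.Site d → Fin d → Matrix n n ℂ)
    (y : B7Prop1Explicit.Site d) (κ : Fin d) : liftDir L X ((L : ℤ) • y) κ = X y κ := by
  unfold liftDir
  congr 1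
  funext i
  have hL0 : (L : ℤ) ≠ 0 := by exact_mod_cast (by omega : L ≠ 0)
  simp [Pi.smul_apply, Int.mul_ediv_cancel_left _ hL0]

/-- `W e^{sX}` on run A's lattice IS the rescaled `\overline{U_B} e^{sΦ}`: `vary (cavg L U) X s = rescale L (vary (bavg L U) Φ s)`.
[folklore] -/
theorem vary_cavg_eq_rescale {L : ℕ} (hL : 1 ≤ L) (U : B7Prop1Explicit.Site d → Fin d → (Matrix n n ℂ)ˣ)
    (X : B7Prop1Explicit.Site d → Fin d → Matrix n n ℂ) (s : ℝ) :
    vary (cavg L U) X s = rescale L (vary (bavg L U) (liftDir L X) s) := by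
  funext y κ
  simp only [vary, rescale_apply, cavg, liftDir_smul hL]

/-- **The run-A Wilson action of `W e^{sX}` on a window of run-A plaquettes is the coarse (`L`-lattice) action of
`\overline{U_B} e^{sΦ}` on the same index set.** [folklore] -/
theorem fineAction_vary_cavg {L : ℕ} (hL : 1 ≤ L) (U : B7Prop1Explicit.Site d → Fin d → (Matrix n n ℂ)ˣ)
    (X : B7Prop1Explicit.Site d → Fin d → Matrix n n ℂ) (s : ℝ) (Wc : Finset (T4AveragingDeficitWall.Plaq d)) :
    fineAction (vary (cavg L U) X s) Wc = coarseActionOf L (vary (bavg L U) (liftDir L X) s) Wc := by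
  rw [vary_cavg_eq_rescale hL]
  unfold fineAction AveragingDeficitResidualPairing.coarseActionOf
  exact Finset.sum_congr rfl fun P _ => by rw [fhol_rescale]

/-- `coarseSq M X = dirSq X (periodBox M)` and `coarseL1 M X = dirL1 X (periodBox M)` (same sums). [folklore] -/
theorem coarseSq_eq_dirSq (M : ℕ) (X : B7Prop1Explicit.Site d → Fin d → Matrix n n ℂ) :
    coarseSq M X = dirSq X (periodBox M) ∧ coarseL1 M X = dirL1 X (periodBox M) := ⟨rfl, rfl⟩

/-- `√(dirSq) ≤ energyNorm`. [folklore] -/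
theorem sqrt_dirSq_le_energyNorm (W : B7Prop1Explicit.Site d → Fin d → (Matrix n n ℂ)ˣ)
    (X : B7Prop1Explicit.Site d → Fin d → Matrix n n ℂ) (F : Finset (B7Prop1Explicit.Site d)) :
    Real.sqrt (dirSq X F) ≤ energyNorm W X F := by
  unfold NE3EnergyShapes.energyNorm
  refine Real.sqrt_le_sqrt ?_
  have : 0 ≤ curlSq W X F := by unfold curlSq; positivity
  linarith

/-! ## §3 The dual residual in the route's currency -/

/-- **LEAF L9 IN THE ROUTE'S CURRENCY (typer row Y9).**  Levels written `j+1` (run A) and `j+2` (run B).  For a run-B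
minimiser `U_B` of the class `sfClass L N ε` with datum `V` that is `Regular d L N b g (j+2)` with `0 ≤ b < ε`, under the
multi-level smallness `LevelSmall d L (j+1) (ε/(L^{j+2})²)`, put `W := cavg L U_B`.  For every `𝔲(N)` direction `X`,
`(N·L^{j+1})`-periodic and tangent to run A's fibre at `W` (`TangentIter L j W X`), and every `D` with
`HasDerivAt (s ↦ fineAction (vary W X s) (perWin (N·L^{j+1}))) D 0`:
  `|D| ≤ residualScale d L N b g (j+1) · energyNorm W X (periodBox (N·L^{j+1}))`.
Inputs BY NAME: `dualResidual_avgIter` (row NE3-R2), `coarseL1_le_sqrt`, `Regular.grad/small/unitary/periodic`.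
[folklore] -/
theorem abs_deriv_action_le_residualScale [Nonempty n] {L N : ℕ} [NeZero L] [NeZero N] (hL : 1 ≤ L)
    (j : ℕ) {ε b g : ℝ} (hb : 0 ≤ b) (hbε : b < ε)
    (hsmall : LevelSmall d L (j + 1) (ε / ((L : ℝ) ^ (j + 2)) ^ 2))
    {V UB : B7Prop1Explicit.Site d → Fin d → (Matrix n n ℂ)ˣ}
    (hB : IsMinimiser d (sfClass d L N ε) L N (j + 2) V UB) (hreg : Regular d L N b g (j + 2) UB)
    (X : B7Prop1Explicit.Site d → Fin d → Matrix n n ℂ) (hXs : IsSkewDir X)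
    (hXP : IsPeriodicDir X ((N * L ^ (j + 1) : ℕ) : ℤ)) (hXT : TangentIter L j (cavg L UB) X) {D : ℝ}
    (hD : HasDerivAt (fun s : ℝ => fineAction (vary (cavg L UB) X s) (perWin d (N * L ^ (j + 1)))) D 0) :
    |D| ≤ residualScale d L N b g (j + 1) * energyNorm (cavg L UB) X (periodBox (N * L ^ (j + 1))) := by
  -- arithmetic of the tower
  have hM : L * tower L N j = N * L ^ (j + 1) := by rw [tower_eq]; ring
  have hM2 : L * (L * tower L N j) = N * L ^ (j + 2) := by rw [hM]; ring
  have hL0 : (0 : ℝ) < L := by exact_mod_cast hL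
  have hLpos : (0 : ℝ) < (L : ℝ) ^ (j + 2) := pow_pos hL0 _
  -- the data of `dualResidual_avgIter`
  have hV : IsUnitaryCfg UB := hreg.unitary
  have hVP : IsPeriodicCfg UB ((L : ℤ) * (L * tower L N j : ℕ)) := by
    have h := hreg.periodic
    have hc : ((L : ℤ) * (L * tower L N j : ℕ)) = ((N * L ^ (j + 2) : ℕ) : ℤ) := by
      rw [← hM2]; push_cast; ring
    rw [hc]; exact h
  set a : ℝ := b / ((L : ℝ) ^ (j + 2)) ^ 2 with ha_def
  have ha : 0 ≤ a := div_nonneg hb (by positivity)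
  have hab : a < ε / ((L : ℝ) ^ (j + 2)) ^ 2 := div_lt_div_of_pos_right hbε (by positivity)
  have hVa : SmallField UB a := hreg.small
  have hmin : ∀ U : B7Prop1Explicit.Site d → Fin d → (Matrix n n ℂ)ˣ, IsUnitaryCfg U →
      IsPeriodicCfg U ((L : ℤ) * (L * tower L N j : ℕ)) → SmallField U (ε / ((L : ℝ) ^ (j + 2)) ^ 2) →
        avgIter L U (j + 2) = avgIter L UB (j + 2) →
          fineAction UB (blockWindow L (periodBox (L * tower L N j))).2
            ≤ fineAction U (blockWindow L (periodBox (L * tower L N j))).2 := by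
    intro U hU hUP hUb hUeq
    have hw : (blockWindow L (periodBox (d := d) (L * tower L N j))).2 = perWin d (N * L ^ (j + 2)) := by
      show blockSites L (periodBox (L * tower L N j)) ×ˢ Finset.univ = perWin d (N * L ^ (j + 2))
      rw [blockSites_periodBox L _ hL, hM2]; rfl
    have hUP' : IsPeriodicCfg U ((N * L ^ (j + 2) : ℕ) : ℤ) := by
      have hc : ((L : ℤ) * (L * tower L N j : ℕ)) = ((N * L ^ (j + 2) : ℕ) : ℤ) := by
        rw [← hM2]; push_cast; ring
      rw [← hc]; exact hUP
    rw [hw]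
    exact fineAction_le_of_isMinimiser hL hB U hU hUP' hUb hUeq
  -- the direction data
  have hφs : ∀ (y : B7Prop1Explicit.Site d) (κ : Fin d), X y κ ∈ skewAdjoint (Matrix n n ℂ) := hXs
  have hφP : ∀ (y : B7Prop1Explicit.Site d) (i κ : Fin d), X (y + ((L * tower L N j : ℕ) : ℤ) • e i) κ = X y κ := by
    intro y i κ; rw [hM]; exact hXP y i κ
  have hΦ : ∀ (y : B7Prop1Explicit.Site d) (κ : Fin d), liftDir L X ((L : ℤ) • y) κ = X y κ := liftDir_smul hL X
  -- the derivative in coarse form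
  have hDc : HasDerivAt (fun s : ℝ => coarseActionOf L (vary (bavg L UB) (liftDir L X) s)
      (blockWindow L (periodBox (L * tower L N j))).1) D 0 := by
    have hw1 : (blockWindow L (periodBox (d := d) (L * tower L N j))).1 = perWin d (N * L ^ (j + 1)) := by
      show periodBox (L * tower L N j) ×ˢ Finset.univ = perWin d (N * L ^ (j + 1))
      rw [hM]; rfl
    rw [hw1]
    refine hD.congr_of_eventuallyEq (Filter.Eventually.of_forall fun s => ?_)
    exact (fineAction_vary_cavg hL UB X s _).symm
  -- row NE3-R2's theorem, with the tower arithmetic rewritten to run A's period `N·L^{j+1}`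
  have key := dualResidual_avgIter j hV hVP ha hab hsmall hVa hmin X hφs hφP hXT (liftDir L X) hΦ hDc
  rw [hM] at key
  -- the bracket in the route's currency
  have hEN0 : 0 ≤ energyNorm (cavg L UB) X (periodBox (N * L ^ (j + 1))) := Real.sqrt_nonneg _
  have hgrad : gradFluxSq UB (blockSites L (periodBox (N * L ^ (j + 1))))
      ≤ g * (N : ℝ) ^ d * ((L : ℝ) ^ (j + 2)) ^ d / ((L : ℝ) ^ (j + 2)) ^ 6 := by
    rw [blockSites_periodBox L _ hL, show L * (N * L ^ (j + 1)) = N * L ^ (j + 2) by ring]; exact hreg.grad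
  have hSq : Real.sqrt (coarseSq (N * L ^ (j + 1)) X) ≤ energyNorm (cavg L UB) X (periodBox (N * L ^ (j + 1))) := by
    rw [(coarseSq_eq_dirSq (N * L ^ (j + 1)) X).1]; exact sqrt_dirSq_le_energyNorm _ X _
  have hL1 : coarseL1 (N * L ^ (j + 1)) X
      ≤ Real.sqrt (d * ((N * L ^ (j + 1) : ℕ) : ℝ) ^ d) * energyNorm (cavg L UB) X (periodBox (N * L ^ (j + 1))) :=
    (coarseL1_le_sqrt (N * L ^ (j + 1)) X).trans (mul_le_mul_of_nonneg_left hSq (Real.sqrt_nonneg _))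
  have hC1 : 0 ≤ dualC1 d L := by unfold AveragingDeficitDualResidual.dualC1; positivity
  have hC2 : 0 ≤ dualC2 d L := by unfold AveragingDeficitDualResidual.dualC2; positivity
  have hW0 := wallConst_nonneg d L
  have hbr : wallConst d L * (Real.sqrt (gradFluxSq UB (blockSites L (periodBox (N * L ^ (j + 1)))))
        * (dualC2 d L * Real.sqrt (coarseSq (N * L ^ (j + 1)) X))
          + a ^ 2 * (dualC1 d L * coarseL1 (N * L ^ (j + 1)) X))
      ≤ wallConst d L * ((Real.sqrt (g * (N : ℝ) ^ d * ((L : ℝ) ^ (j + 2)) ^ d / ((L : ℝ) ^ (j + 2)) ^ 6) * dualC2 d L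
          + a ^ 2 * dualC1 d L * Real.sqrt (d * ((N * L ^ (j + 1) : ℕ) : ℝ) ^ d))
          * energyNorm (cavg L UB) X (periodBox (N * L ^ (j + 1)))) := by
    refine mul_le_mul_of_nonneg_left ?_ hW0
    have h1 : Real.sqrt (gradFluxSq UB (blockSites L (periodBox (N * L ^ (j + 1)))))
        * (dualC2 d L * Real.sqrt (coarseSq (N * L ^ (j + 1)) X))
          ≤ Real.sqrt (g * (N : ℝ) ^ d * ((L : ℝ) ^ (j + 2)) ^ d / ((L : ℝ) ^ (j + 2)) ^ 6)
            * (dualC2 d L * energyNorm (cavg L UB) X (periodBox (N * L ^ (j + 1)))) :=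
      mul_le_mul (Real.sqrt_le_sqrt hgrad) (mul_le_mul_of_nonneg_left hSq hC2)
        (mul_nonneg hC2 (Real.sqrt_nonneg _)) (Real.sqrt_nonneg _)
    have h2 : a ^ 2 * (dualC1 d L * coarseL1 (N * L ^ (j + 1)) X)
        ≤ a ^ 2 * (dualC1 d L * (Real.sqrt (d * ((N * L ^ (j + 1) : ℕ) : ℝ) ^ d)
            * energyNorm (cavg L UB) X (periodBox (N * L ^ (j + 1))))) :=
      mul_le_mul_of_nonneg_left (mul_le_mul_of_nonneg_left hL1 hC1) (sq_nonneg a)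
    nlinarith
  have key' := key.trans hbr
  -- divide by `L^{d−4}`
  have hzp : (0 : ℝ) < (L : ℝ) ^ ((d : ℤ) - 4) := zpow_pos hL0 _
  have hinv : ((L : ℝ) ^ ((d : ℤ) - 4))⁻¹ = (L : ℝ) ^ (4 - (d : ℤ)) := by
    rw [← zpow_neg]; congr 1; ring
  have hfin : |D| ≤ (L : ℝ) ^ (4 - (d : ℤ)) * (wallConst d L *
      ((Real.sqrt (g * (N : ℝ) ^ d * ((L : ℝ) ^ (j + 2)) ^ d / ((L : ℝ) ^ (j + 2)) ^ 6) * dualC2 d L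
          + a ^ 2 * dualC1 d L * Real.sqrt (d * ((N * L ^ (j + 1) : ℕ) : ℝ) ^ d))
        * energyNorm (cavg L UB) X (periodBox (N * L ^ (j + 1))))) := by
    rw [← hinv, ← div_eq_inv_mul, le_div_iff₀ hzp, mul_comm]
    exact key'
  refine hfin.trans (le_of_eq ?_)
  rw [ha_def]
  simp only [NE3EnergyShapes.residualScale]
  ring

end

end Summit.QuantumFields.BalabanUV.T4Continuum.NE3EnergyResidual
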